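import Mathlib
import Literature.AlgebraicGeometry.Resolution.LipmanValuativeQuadraticSequence
import Literature.AlgebraicGeometry.Resolution.BlowupStalkEmbedding
import Literature.AlgebraicGeometry.Resolution.HilbertSamuelIsolatedSingularities
import Literature.AlgebraicGeometry.Resolution.AffineDomainDimension
import HarnessLib

/-!
# Lipman's theorem, valuative corollary: the reduction to `Lipman1978SequenceFinite` (PROVED)

Topic: `Literature/AlgebraicGeometry/Resolution`. Companion of `LipmanValuativeQuadraticSequence.lean`,
which states the named fact `Lipman1978ValuativeQuadraticSequence` (Lipman 1978, Theorem p. 151 =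
Liu 2002, Thm. 8.3.44, followed along a valuation ring `O` of the function field `K`: the
normalised quadratic transforms of a normal surface germ along `O` reach a regular local ring) and
explains in its module docstring why it is a COROLLARY of the scheme-level statement
`Lipman1978SequenceFinite` (`LipmanTermination.lean`: some iterate `X_n = step^[n] X` of "blow up
the reduced singular locus, then normalize" is regular, for every normal surface `X/k`).  This file
PROVES that reduction:

* `Lipman1978ValuativeQuadraticSequence.of_sequenceFinite :
    Lipman1978SequenceFinite → Lipman1978ValuativeQuadraticSequence` — **MAIN**.

The proof is the dictionary "local rings of Lipman's sequence at the centres of `O`, read inside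
`K`" (Liu 2002, §8.3.4, proof of Lemma 8.3.46 / Thm. 8.3.44; Lipman 1978, §2), assembled from the
tree's blow-up and normalization infrastructure; every step is proved here, no named fact is
introduced:

* §0 (subrings of `K` along `O`): the three `Algebra.adjoin` constructs of the statement are the
  chart ring `R[𝔪_R/x]` (`blowupRing`, `adjoin_union_toSubring_eq_blowupRing`), the integral
  closure in `K` (`adjoin_setOf_isIntegral_toSubring_eq`) and the localisation at the centre of `O`
  (`locAtCentre`, `adjoin_mul_inv_toSubring_eq_locAtCentre`); localising at the centre commutes with
  the integral closure (`locAtCentre_integralClosure_locAtCentre`); the localised chart does not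
  depend on the element of maximal value (`locAtCentre_blowupRing_eq_of_valuation_eq`).
* §2 (blow-up half, for ANY blowing up `π : X' → X` in the sense of `IsBlowup` of an integral
  locally Noetherian scheme): `IsBlowup.exists_chart_morphism_of_index` (the chart `Spec B_j → X'`
  exists for every generator `c_j` of `J_s`, variant of `IsBlowup.exists_chart_morphism`),
  `IsBlowup.range_comp_stalkEmb_of_chart` and
  `IsBlowup.exists_point_range_eq_locAtCentre_blowupRing`: if `J_s = 𝔪_s` and `𝒪_{X,s}` embeds
  into `K` with image `R ⊆ O` dominated by `O`, some `x' ∈ X'` over `s` has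
  `𝒪_{X',x'} ≅ (R[𝔪_R/x])_{𝔪_O}` inside `K` (through the canonical embedding `stalkEmb` into
  `K(X)`), for any `x ∈ 𝔪_R` of maximal value (Stacks 0804: the point is the centre `chartCentre`
  of `O` on the chart at a generator of maximal value).
* §3 (normalization half, for any integral scheme `Y`): `exists_point_normalization_range_eq` — if
  `𝒪_{Y,y}` embeds into `K` with image `R ⊆ O` dominated by `O` and `Frac R = K`, some point of
  the normalization `Y^ν` has local ring `(IC_K R)_{𝔪_O}` inside `K` (over an affine `U ∋ y`,
  `Y^ν = Spec` of the integral closure, Mathlib `Scheme.Hom.normalizationObjIso`).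
* §4 (initial model): `exists_normalSurface_point_range_eq` — a normal local `R₀ ⊆ O` essentially
  of finite type over `k` with `Frac = K`, `tr.deg_k K = 2`, equal to its localisation at the
  centre, is `𝒪_{X,P}` for the affine normal surface `X = Spec A'`, `A'` the integral closure of a
  finitely generated model (finite by `NoetherFiniteIntegralClosure_holds`, of dimension `2` by
  `exists_ringKrullDim_eq_and_trdeg_eq`).
* §5 (assembly): `NormalSurface.exists_point_step_range_eq` (one step of (3.11) along `O`: `Sing X`
  is a finite set of closed points, `stalkIdeal_vanishingIdeal_of_finite`, then §2 and §3),
  `NormalSurface.exists_point_iterate_range_eq` (induction), and the main theorem (if no `R i` were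
  regular they would all be local rings of the `X_i`, contradicting `Lipman1978SequenceFinite`).

## References

* J. Lipman, *Desingularization of two-dimensional schemes*, Ann. of Math. 107 (1978) 151–207,
  Theorem p. 151 and §2. [Lipman1978]
* Q. Liu, *Algebraic Geometry and Arithmetic Curves*, OUP 2002, §8.3.4: (3.11), Lemma 8.3.46,
  Thm. 8.3.44 (p. 362); Def. 4.1.24, Prop. 4.1.27, Cor. 4.1.30 (normalization). [Liu2002]
* The Stacks Project, Tag 0804 (affine charts of a blowing up), Tag 0805 (flat base change),
  Tag 035H (relative normalization). [StacksProject]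
* S. D. Cutkosky, *Resolution of Singularities*, AMS 2004, §2.2 (quadratic transforms along a
  valuation). [Cutkosky2014]
* H. Matsumura, *Commutative Ring Theory*, CUP 1987, Thm. 5.6 (dimension of affine domains).
  [Matsumura1987]
-/

noncomputable section

open IsLocalRing AlgebraicGeometry CategoryTheory

namespace Literature.AlgebraicGeometry.Resolution

universe u

/-! ## §0 Subrings of a field along a valuation ring -/

section SubringAlgebra

variable {K : Type u} [Field K] (O : ValuationSubring K)

/-- An element of `O` whose inverse lies in `O` is `0` or has value `1`. [folklore] -/
private theorem valuation_eq_one_of_inv_mem_valuationSubring {s : K} (hs : s ∈ O) (hsi : s⁻¹ ∈ O)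
    (hs0 : s ≠ 0) : O.valuation s = 1 := by
  refine le_antisymm ((O.valuation_le_one_iff _).mpr hs) ?_
  have h1 : O.valuation s⁻¹ ≤ 1 := (O.valuation_le_one_iff _).mpr hsi
  rwa [map_inv₀, inv_le_one₀ (pos_iff_ne_zero.mpr ((map_ne_zero _).mpr hs0))] at h1

/-- An element of value `1` has its inverse in `O`. [folklore] -/
private theorem valuationSubring_inv_mem_of_valuation_eq_one {s : K} (hs : O.valuation s = 1) : s⁻¹ ∈ O := by
  rw [← O.valuation_le_one_iff, map_inv₀, hs, inv_one]

/-- For `B ⊆ O`, the fractions `a · s⁻¹` (`a, s ∈ B`, `s⁻¹ ∈ O`) are exactly the elements of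
`locAtCentre B O`. [folklore] -/
private theorem setOf_mul_inv_eq_locAtCentre {B : Subring K} (hB : B ≤ O.toSubring) :
    {y : K | ∃ a ∈ B, ∃ s ∈ B, s⁻¹ ∈ O ∧ y = a * s⁻¹} = (locAtCentre B O : Set K) := by
  ext y
  simp only [Set.mem_setOf_eq, SetLike.mem_coe, mem_locAtCentre_iff]
  constructor
  · rintro ⟨a, ha, s, hs, hsi, rfl⟩
    by_cases hs0 : s = 0
    · exact ⟨0, B.zero_mem, 1, B.one_mem, by simp, by simp [hs0]⟩
    · exact ⟨a, ha, s, hs, valuation_eq_one_of_inv_mem_valuationSubring O (hB hs) hsi hs0,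
        by rw [div_eq_mul_inv]⟩
  · rintro ⟨a, ha, s, hs, hvs, rfl⟩
    exact ⟨a, ha, s, hs, valuationSubring_inv_mem_of_valuation_eq_one O hvs, by rw [div_eq_mul_inv]⟩

/-- `Algebra.adjoin k S = S` (as subrings) when `S` is a subring containing the image of `k`.
[folklore] -/
private theorem adjoin_toSubring_eq_of_subring {k : Type u} [Field k] [Algebra k K] (S : Subring K)
    (hk : ∀ c : k, algebraMap k K c ∈ S) :
    (Algebra.adjoin k (S : Set K)).toSubring = S := by
  rw [Algebra.adjoin_eq_ring_closure]
  refine le_antisymm (Subring.closure_le.mpr ?_) ?_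
  · rintro z (⟨c, rfl⟩ | hz)
    · exact hk c
    · exact hz
  · exact fun z hz => Subring.subset_closure (Or.inr hz)

/-- **Conversion (T3).** For a `k`-subalgebra `B ⊆ O`, the `k`-algebra generated by the
fractions `a · s⁻¹` (`a, s ∈ B`, `s⁻¹ ∈ O`) is the localisation of `B` at the centre of `O`.
[folklore] -/
theorem adjoin_mul_inv_toSubring_eq_locAtCentre {k : Type u} [Field k] [Algebra k K]
    (B : Subalgebra k K) (hB : B.toSubring ≤ O.toSubring) :
    (Algebra.adjoin k {y : K | ∃ a ∈ B, ∃ s ∈ B, s⁻¹ ∈ O ∧ y = a * s⁻¹}).toSubring =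
      locAtCentre B.toSubring O := by
  have h := setOf_mul_inv_eq_locAtCentre O hB
  have h' : {y : K | ∃ a ∈ B, ∃ s ∈ B, s⁻¹ ∈ O ∧ y = a * s⁻¹} =
      ((locAtCentre B.toSubring O : Subring K) : Set K) := by
    rw [← h]; rfl
  rw [h']
  refine adjoin_toSubring_eq_of_subring (locAtCentre B.toSubring O) fun c => ?_
  exact le_locAtCentre _ O (B.algebraMap_mem c)

/-- Integrality over a subring passes to larger subrings. [folklore] -/
private theorem isIntegral_of_subring_le_subring {S S' : Subring K} (h : S ≤ S') {z : K}
    (hz : IsIntegral S z) : IsIntegral S' z := by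
  obtain ⟨p, hp, hpz⟩ := hz
  refine ⟨p.map (Subring.inclusion h), hp.map _, ?_⟩
  rw [Polynomial.eval₂_map]
  have : (algebraMap S' K).comp (Subring.inclusion h) = algebraMap S K := RingHom.ext fun _ => rfl
  rw [this, hpz]

/-- Integrality over a `k`-subalgebra is integrality over its underlying subring. [folklore] -/
private theorem isIntegral_subalgebra_iff {k : Type u} [Field k] [Algebra k K] (B : Subalgebra k K)
    (z : K) : IsIntegral B z ↔ IsIntegral B.toSubring z := by
  constructor
  · rintro ⟨p, hp, hpz⟩
    let e : B →+* B.toSubring :=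
      { toFun := fun x => ⟨x.1, x.2⟩, map_one' := rfl, map_mul' := fun _ _ => rfl,
        map_zero' := rfl, map_add' := fun _ _ => rfl }
    refine ⟨p.map e, hp.map _, ?_⟩
    rw [Polynomial.eval₂_map]
    have : (algebraMap B.toSubring K).comp e = algebraMap B K := RingHom.ext fun _ => rfl
    rw [this, hpz]
  · rintro ⟨p, hp, hpz⟩
    let e : B.toSubring →+* B :=
      { toFun := fun x => ⟨x.1, x.2⟩, map_one' := rfl, map_mul' := fun _ _ => rfl,
        map_zero' := rfl, map_add' := fun _ _ => rfl }
    refine ⟨p.map e, hp.map _, ?_⟩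
    rw [Polynomial.eval₂_map]
    have : (algebraMap B K).comp e = algebraMap B.toSubring K := RingHom.ext fun _ => rfl
    rw [this, hpz]

/-- **Conversion (T2).** The `k`-algebra generated by the elements integral over a
`k`-subalgebra `B` is the integral closure of (the subring) `B` in `K`. [folklore] -/
theorem adjoin_setOf_isIntegral_toSubring_eq {k : Type u} [Field k] [Algebra k K]
    (B : Subalgebra k K) :
    (Algebra.adjoin k {z : K | IsIntegral B z}).toSubring =
      (integralClosure B.toSubring K).toSubring := by
  have h' : {z : K | IsIntegral B z} = ((integralClosure B.toSubring K).toSubring : Set K) := by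
    ext z
    rw [Set.mem_setOf_eq, isIntegral_subalgebra_iff]
    rfl
  rw [h']
  refine adjoin_toSubring_eq_of_subring _ fun c => ?_
  change IsIntegral B.toSubring (algebraMap k K c)
  exact (isIntegral_subalgebra_iff B _).mp (isIntegral_algebraMap (R := B) (A := K)
    (x := (⟨algebraMap k K c, B.algebraMap_mem c⟩ : B)))

/-- **Conversion (T1).** For a local `k`-subalgebra `R ⊆ O` dominated by `O` and `x ∈ K`, the
`k`-algebra generated by `R` and the `a · x⁻¹` with `a ∈ R` of positive value is the chart ring
`R[𝔪_R/x]` (`blowupRing`). [folklore] -/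
theorem adjoin_union_toSubring_eq_blowupRing {k : Type u} [Field k] [Algebra k K]
    (R : Subalgebra k K) [IsLocalRing R.toSubring]
    (hdom : ∀ a : R.toSubring, a ∈ maximalIdeal R.toSubring ↔ O.valuation (a : K) < 1) (x : K) :
    (Algebra.adjoin k ((R : Set K) ∪ {w : K | ∃ a ∈ R, O.valuation a < 1 ∧ w = a * x⁻¹})).toSubring =
      blowupRing R.toSubring x := by
  rw [Algebra.adjoin_eq_ring_closure, blowupRing]
  have hset : Set.range (algebraMap k K) ∪ ((R : Set K) ∪ {w : K | ∃ a ∈ R, O.valuation a < 1 ∧ w = a * x⁻¹}) =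
      (R.toSubring : Set K) ∪ (fun y : R.toSubring => (y : K) / x) '' (maximalIdeal R.toSubring : Set R.toSubring) := by
    ext w
    simp only [Set.mem_union, Set.mem_range, Set.mem_setOf_eq, Set.mem_image, SetLike.mem_coe]
    constructor
    · rintro (⟨c, rfl⟩ | hw | ⟨a, ha, hva, rfl⟩)
      · exact Or.inl (R.algebraMap_mem c)
      · exact Or.inl hw
      · exact Or.inr ⟨⟨a, ha⟩, (hdom ⟨a, ha⟩).mpr hva, by rw [div_eq_mul_inv]⟩
    · rintro (hw | ⟨a, ha, rfl⟩)
      · exact Or.inr (Or.inl hw)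
      · exact Or.inr (Or.inr ⟨a, a.2, (hdom a).mp ha, by rw [div_eq_mul_inv]⟩)
  rw [hset]

/-- Localising at the centre of `O` commutes with taking the integral closure in `K`:
`(IC (B_{𝔪_O ∩ B}))_{𝔪_O} = (IC B)_{𝔪_O}` for `B ⊆ O` (clear the denominators of an integral
dependence relation over the localisation). [folklore] -/
theorem locAtCentre_integralClosure_locAtCentre {B : Subring K} (hB : B ≤ O.toSubring) :
    locAtCentre (integralClosure (locAtCentre B O) K).toSubring O =
      locAtCentre (integralClosure B K).toSubring O := by
  haveI := isLocalization_locAtCentre hB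
  -- every element integral over `B_{𝔪_O ∩ B}` becomes integral over `B` after multiplying by
  -- an element of `B` of value `1`
  have key : ∀ a : K, IsIntegral (locAtCentre B O) a →
      ∃ t ∈ B, O.valuation t = 1 ∧ IsIntegral B (t * a) := by
    intro a ha
    obtain ⟨m, hm⟩ := IsIntegral.exists_multiple_integral_of_isLocalization
      (subringCentre B O hB).primeCompl (Rₘ := locAtCentre B O) a ha
    refine ⟨(m : B), (m : B).2, valuation_eq_one_of_not_mem_subringCentre hB m.2, ?_⟩
    have : (m • a : K) = ((m : B) : K) * a := by
      rw [Submonoid.smul_def, Algebra.smul_def]; rfl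
    rwa [this] at hm
  apply le_antisymm
  · rintro _ ⟨a, ha, s, hs, hvs, rfl⟩
    obtain ⟨t, ht, hvt, hta⟩ := key a ha
    obtain ⟨t', ht', hvt', ht's⟩ := key s hs
    have ht0 := ne_zero_of_valuation_eq_one hvt
    have ht'0 := ne_zero_of_valuation_eq_one hvt'
    have hs0 := ne_zero_of_valuation_eq_one hvs
    refine ⟨t * a * t', Subring.mul_mem _ hta (le_integralClosure_self' ht'), t' * s * t,
      Subring.mul_mem _ ht's (le_integralClosure_self' ht), by simp [hvt, hvt', hvs], ?_⟩
    field_simp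
  · refine locAtCentre_mono O fun z hz => ?_
    exact isIntegral_of_subring_le_subring (le_locAtCentre B O) hz
  where
    /-- elements of `B` are integral over `B` -/
    le_integralClosure_self' {t : K} (ht : t ∈ B) : t ∈ (integralClosure B K).toSubring :=
      isIntegral_algebraMap (R := B) (A := K) (x := (⟨t, ht⟩ : B))

/-- The localised chart `R[𝔪_R/x]_{𝔪_O}` does not depend on the choice of the element `x ∈ 𝔪_R`
among those of a given value (for two such, `x/x'` is a unit of `O`). [cite: Cutkosky2014, §2.2] -/
theorem locAtCentre_blowupRing_eq_of_valuation_eq {R : Subring K} [IsLocalRing R] {a b : K}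
    (ha : a ∈ R) (hb : b ∈ R) (ham : (⟨a, ha⟩ : R) ∈ maximalIdeal R) (hbm : (⟨b, hb⟩ : R) ∈ maximalIdeal R)
    (ha0 : a ≠ 0) (hb0 : b ≠ 0) (hab : O.valuation a = O.valuation b) :
    locAtCentre (blowupRing R a) O = locAtCentre (blowupRing R b) O := by
  have key : ∀ (a b : K) (ha : a ∈ R) (_ : b ∈ R), (⟨a, ha⟩ : R) ∈ maximalIdeal R → a ≠ 0 → b ≠ 0 →
      O.valuation a = O.valuation b → blowupRing R a ≤ locAtCentre (blowupRing R b) O := by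
    intro a b ha hb ham ha0 hb0 hab
    refine Subring.closure_le.mpr ?_
    rintro z (hz | ⟨y, hy, rfl⟩)
    · exact le_locAtCentre _ O (le_blowupRing R _ hz)
    · have hab1 : O.valuation (a / b) = 1 := by
        rw [map_div₀, hab, div_self ((map_ne_zero _).mpr hb0)]
      refine ⟨(y : K) / b, div_mem_blowupRing _ hy, a / b, div_mem_blowupRing (y := ⟨a, ha⟩) _ ham,
        hab1, ?_⟩
      field_simp
  apply le_antisymm
  · calc locAtCentre (blowupRing R a) O
        ≤ locAtCentre (locAtCentre (blowupRing R b) O) O :=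
          locAtCentre_mono O (key a b ha hb ham ha0 hb0 hab)
      _ = locAtCentre (blowupRing R b) O := locAtCentre_locAtCentre _ O
  · calc locAtCentre (blowupRing R b) O
        ≤ locAtCentre (locAtCentre (blowupRing R a) O) O :=
          locAtCentre_mono O (key b a hb ha hbm hb0 ha0 hab.symm)
      _ = locAtCentre (blowupRing R a) O := locAtCentre_locAtCentre _ O

/-- The image in `K` of a local ring under a ring homomorphism onto a subring `R` is a local ring.
[folklore] -/
theorem isLocalRing_of_range_eq {A : Type*} [CommRing A] [IsLocalRing A] (ψ : A →+* K)
    (R : Subring K) (hR : ψ.range = R) : IsLocalRing R := by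
  haveI : Nontrivial R := inferInstance
  refine IsLocalRing.of_surjective' ((RingEquiv.subringCongr hR).toRingHom.comp ψ.rangeRestrict) ?_
  exact (RingEquiv.subringCongr hR).surjective.comp ψ.rangeRestrict_surjective

/-- For an embedding `ψ : A ↪ K` of a local ring with image `R`, domination of `A` by `O` (read
through `ψ`) is domination of `R` by `O`. [folklore] -/
theorem mem_maximalIdeal_iff_of_range_eq {A : Type*} [CommRing A] [IsLocalRing A] (ψ : A →+* K)
    (hψ : Function.Injective ψ) (R : Subring K) [IsLocalRing R] (hR : ψ.range = R)
    (hdom : ∀ r, r ∈ maximalIdeal A ↔ O.valuation (ψ r) < 1) (a : R) :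
    a ∈ maximalIdeal R ↔ O.valuation (a : K) < 1 := by
  obtain ⟨r, hr⟩ : (a : K) ∈ ψ.range := hR ▸ a.2
  let e : A ≃+* R := (RingEquiv.ofBijective ψ.rangeRestrict
    ⟨fun x y h => hψ (congrArg Subtype.val h), ψ.rangeRestrict_surjective⟩).trans
    (RingEquiv.subringCongr hR)
  have hea : e r = a := Subtype.ext hr
  rw [← hr, ← hdom r, IsLocalRing.mem_maximalIdeal, IsLocalRing.mem_maximalIdeal, mem_nonunits_iff,
    mem_nonunits_iff, ← hea]
  exact (isUnit_map_iff e r).not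

/-- If `ψ : A ↪ K` has image `B_{𝔪_O ∩ B}` for some `B ⊆ O`, then `A` is dominated by `O` through
`ψ`: its non-units are the elements of positive value. [folklore] -/
theorem mem_maximalIdeal_iff_of_range_eq_locAtCentre {A : Type*} [CommRing A] [IsLocalRing A]
    (ψ : A →+* K) (hψ : Function.Injective ψ) {B : Subring K} (hB : B ≤ O.toSubring)
    (hR : ψ.range = locAtCentre B O) (r : A) :
    r ∈ maximalIdeal A ↔ O.valuation (ψ r) < 1 := by
  let e : A ≃+* locAtCentre B O := (RingEquiv.ofBijective ψ.rangeRestrict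
    ⟨fun x y h => hψ (congrArg Subtype.val h), ψ.rangeRestrict_surjective⟩).trans
    (RingEquiv.subringCongr hR)
  have her : ((e r : locAtCentre B O) : K) = ψ r := rfl
  rw [IsLocalRing.mem_maximalIdeal, mem_nonunits_iff, ← her, ← not_isUnit_locAtCentre_iff hB]
  exact (isUnit_map_iff e r).not.symm

/-- Regularity is read off the image: for an embedding `ψ : A ↪ K` with image the underlying
subring of a `k`-subalgebra `R`, `A` is a regular local ring iff `R` is. [folklore] -/
theorem isRegularLocalRing_iff_of_range_eq {k : Type u} [Field k] [Algebra k K] {A : Type u}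
    [CommRing A] (ψ : A →+* K) (hψ : Function.Injective ψ) (R : Subalgebra k K)
    (hR : ψ.range = R.toSubring) : IsRegularLocalRing A ↔ IsRegularLocalRing R := by
  let e₀ : R.toSubring ≃+* R :=
    { toFun := fun x => ⟨x.1, x.2⟩, invFun := fun x => ⟨x.1, x.2⟩, left_inv := fun _ => rfl,
      right_inv := fun _ => rfl, map_mul' := fun _ _ => rfl, map_add' := fun _ _ => rfl }
  let e : A ≃+* R := ((RingEquiv.ofBijective ψ.rangeRestrict
    ⟨fun x y h => hψ (congrArg Subtype.val h), ψ.rangeRestrict_surjective⟩).trans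
    (RingEquiv.subringCongr hR)).trans e₀
  exact ⟨fun _ => IsRegularLocalRing.of_ringEquiv e, fun _ => IsRegularLocalRing.of_ringEquiv e.symm⟩

end SubringAlgebra

/-! ## §2 The blow-up half: the local ring of a blowing up at the centre of a valuation -/

section BlowupHalf

open Scheme.IdealSheafData Limits

variable {X' X : Scheme.{u}} {π : X' ⟶ X} {J : X.IdealSheafData}

set_option maxHeartbeats 800000 in
-- the comparison with `Proj` over `Spec 𝒪_{X,s}` elaborates large terms
/-- **Every chart `Spec B_j → X'` of the blowing up of `Spec 𝒪_{X,s}` along `J_s = (c₁,…,c_m)`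
maps to the blowing up `X'`, inducing isomorphisms on all local rings** (the variant of
`IsBlowup.exists_chart_morphism` in which the index `j` is prescribed rather than the point of
`X'`): blowing ups commute with the flat base change `Spec 𝒪_{X,s} → X` and are unique, so
`X' ×_X Spec 𝒪_{X,s} ≅ Proj 𝒪_{X,s}[J_s t] ⊇ Spec B_j`. [cite: StacksProject, Tag 0804 and Tag 0805] -/
theorem IsBlowup.exists_chart_morphism_of_index (hπ : IsBlowup π J) (s : X) {m : ℕ}
    (c : Fin m → X.presheaf.stalk s) (hc : Ideal.span (Set.range c) = stalkIdeal J s) (j : Fin m) :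
    ∃ q : Spec (.of (chartRing c j)) ⟶ X',
      (∀ w, IsIso (q.stalkMap w)) ∧
        q ≫ π = Spec.map (CommRingCat.ofHom (chartBase c j)) ≫ X.fromSpecStalk s := by
  classical
  have hcj : ∀ j, c j ∈ Ideal.span (Set.range c) := fun j =>
    Ideal.mem_span_range_self (f := c) (x := j)
  haveI : Flat (X.fromSpecStalk s) := flat_fromSpecStalk X s
  -- the base change `X' ×_X Spec 𝒪_{X,s} → Spec 𝒪_{X,s}` is a blowing up along `(c)~`
  have hP : IsBlowup (pullback.snd π (X.fromSpecStalk s))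
      (affineBlowup.idealSheaf (Ideal.span (Set.range c))) := by
    have h := hπ.pullback_snd_of_flat (X.fromSpecStalk s)
    rwa [comap_fromSpecStalk_eq_affineBlowupIdealSheaf, ← hc] at h
  -- hence isomorphic to `Proj 𝒪_{X,s}[J_s t]` over `Spec 𝒪_{X,s}`
  obtain ⟨e, he, -⟩ := (affineBlowup.isBlowup (Ideal.span (Set.range c))).unique hP
  refine ⟨(affineBlowup.chartι (c j) (hcj j) ≫ e.hom) ≫ pullback.fst π (X.fromSpecStalk s),
    fun w => ?_, ?_⟩
  · -- isomorphism on local rings: an open immersion followed by a pro-open immersion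
    have h1 := isIso_stalkMap_pullback_fst_fromSpecStalk π s
      ((affineBlowup.chartι (c j) (hcj j) ≫ e.hom) w)
    haveI : IsOpenImmersion (affineBlowup.chartι (c j) (hcj j) ≫ e.hom) := inferInstance
    have h2 : IsIso ((affineBlowup.chartι (c j) (hcj j) ≫ e.hom).stalkMap w) := inferInstance
    rw [Scheme.Hom.stalkMap_comp]
    exact @IsIso.comp_isIso _ _ _ _ _ _ _ h1 h2
  · rw [Category.assoc, pullback.condition, Category.assoc, reassoc_of% he, ← Category.assoc,
      affineBlowup.chartι_π (c j) (hcj j)]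

variable [IsIntegral X] [IsLocallyNoetherian X] {K : Type u} [Field K] (O : ValuationSubring K)

set_option maxHeartbeats 800000 in
-- `IsLocalization.ringHom_ext` over the chart ring unifies large instance terms
/-- **The local ring of the blowing up at a point of the chart through the centre of `O`, read in
`K`.** Let `x' ∈ X'` lie over `s`, let `c₁, …, c_m` generate `𝔪_s = J_s`, let
`θ : 𝒪_{X,s} → K` (the restriction of `F : K(X) → K`) have local image `R ⊆ O`, and let
`q : Spec B_j → X'` be a chart through `x' = q(𝔴)` at the centre `𝔴` of `O` on `B_j`
(`chartCentre`; `θ(c_j)` of maximal value). Then the image of `𝒪_{X',x'}` in `K` (through the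
canonical embedding into `K(X)` and `F`) is the localised chart `(R[𝔪_R/θ(c_j)])_{𝔪_O}`.
[cite: StacksProject, Tag 0804] -/
theorem IsBlowup.range_comp_stalkEmb_of_chart (hπ : IsBlowup π J) (x' : X') (s : X)
    (hs : π x' = s) {m : ℕ} (c : Fin m → X.presheaf.stalk s)
    (hc : Ideal.span (Set.range c) = maximalIdeal (X.presheaf.stalk s)) (j : Fin m)
    (F : X.functionField →+* K) (θ : X.presheaf.stalk s →+* K)
    (hFθ : F.comp (algebraMap (X.presheaf.stalk s) X.functionField) = θ)
    (hθ : θ (c j) ≠ 0) (hRO : ∀ r, θ r ∈ O)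
    (hmin : ∀ i, O.valuation (θ (c i)) ≤ O.valuation (θ (c j)))
    (R : Subring K) [IsLocalRing R] (hR : θ.range = R)
    (q : Spec (.of (chartRing c j)) ⟶ X') (w : Spec (.of (chartRing c j)))
    (hw : w.asIdeal = chartCentre c j θ hθ O hRO hmin)
    (hq : q w = x') [IsIso (q.stalkMap w)]
    (hsq : q ≫ π = Spec.map (CommRingCat.ofHom (chartBase c j)) ≫ X.fromSpecStalk s) :
    (F.comp (hπ.stalkEmb x')).range = locAtCentre (blowupRing R (θ (c j))) O := by
  subst hs
  obtain rfl : w = ⟨chartCentre c j θ hθ O hRO hmin, inferInstance⟩ := PrimeSpectrum.ext hw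
  obtain ⟨χ, hχ, hloc, -⟩ :=
    exists_stalk_ringHom_of_chart π x' (CommRingCat.ofHom (chartBase c j)) q _ hq hsq
  letI : Algebra (chartRing c j) (X'.presheaf.stalk x') := χ.toAlgebra
  haveI : IsLocalization.AtPrime (X'.presheaf.stalk x') (chartCentre c j θ hθ O hRO hmin) := hloc
  have hθa : ∀ a, F (hπ.stalkEmb x' (χ (chartBase c j a))) = θ a := by
    intro a
    have h1 : χ (chartBase c j a) = (π.stalkMap x').hom a := hχ a
    rw [h1, hπ.stalkEmb_stalkMap, ← hFθ]
    rfl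
  have h2 : (F.comp (hπ.stalkEmb x')).comp (algebraMap (chartRing c j) (X'.presheaf.stalk x')) =
      chartToField c j θ hθ := by
    refine ringHom_ext_chartBase c j ?_ ?_
    · ext a
      change F (hπ.stalkEmb x' (χ (chartBase c j a))) = chartToField c j θ hθ (chartBase c j a)
      rw [chartToField_reesChartBase, hθa]
    · change F (hπ.stalkEmb x' (χ (chartBase c j (c j)))) ≠ 0
      rw [hθa]
      exact hθ
  have h3 : ∀ b, locToField c j θ hθ O hRO hmin (X'.presheaf.stalk x')
      (algebraMap (chartRing c j) (X'.presheaf.stalk x') b) = chartToField c j θ hθ b :=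
    fun b => locToField_algebraMap c j θ hθ O hRO hmin (X'.presheaf.stalk x') b
  have hg : F.comp (hπ.stalkEmb x') = locToField c j θ hθ O hRO hmin (X'.presheaf.stalk x') := by
    refine IsLocalization.ringHom_ext (chartCentre c j θ hθ O hRO hmin).primeCompl ?_
    rw [h2]
    refine RingHom.ext fun b => ?_
    rw [RingHom.comp_apply, h3]
  rw [hg, range_locToField, range_chartToField_eq_blowupRing c j θ hθ hc R hR]

/-- The valuation of the image of an element of an ideal is bounded by the maximal valuation of
the images of its generators. [folklore] -/
private theorem valuation_le_of_mem_span {A : Type*} [CommRing A] (θ : A →+* K)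
    (hRO : ∀ r, θ r ∈ O) {m : ℕ} (c : Fin m → A) (j : Fin m)
    (hmin : ∀ i, O.valuation (θ (c i)) ≤ O.valuation (θ (c j))) {r : A}
    (hr : r ∈ Ideal.span (Set.range c)) : O.valuation (θ r) ≤ O.valuation (θ (c j)) := by
  induction hr using Submodule.span_induction with
  | mem y hy =>
    obtain ⟨i, rfl⟩ := hy
    exact hmin i
  | zero => simp
  | add y z _ _ hy hz =>
    rw [map_add]
    exact (Valuation.map_add _ _ _).trans (max_le hy hz)
  | smul a y _ hy =>
    rw [smul_eq_mul, map_mul, map_mul]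
    calc O.valuation (θ a) * O.valuation (θ y) ≤ 1 * O.valuation (θ (c j)) :=
          mul_le_mul' ((O.valuation_le_one_iff _).mpr (hRO a)) hy
      _ = O.valuation (θ (c j)) := one_mul _

/-- **The blow-up half of the dictionary.** Let `π : X' → X` be a blowing up along `J` of an
integral locally Noetherian scheme, `s ∈ X` a point with `J_s = 𝔪_s ≠ 0`, and
`ψ : 𝒪_{X,s} ↪ K` an embedding whose image `R ⊆ O` is dominated by the valuation ring `O`.
Then for every `x ∈ 𝔪_R` of maximal value there is a point `x' ∈ X'` over `s` whose local ring
embeds into `K` (compatibly with `ψ`, through the canonical embedding into `K(X)`) with image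
the localised chart `(R[𝔪_R/x])_{𝔪_O ∩ R[𝔪_R/x]}` — the quadratic transform of `R` along `O`.
[cite: StacksProject, Tag 0804] -/
theorem IsBlowup.exists_point_range_eq_locAtCentre_blowupRing (hπ : IsBlowup π J) (s : X)
    (hJ : stalkIdeal J s = maximalIdeal (X.presheaf.stalk s))
    (hne : maximalIdeal (X.presheaf.stalk s) ≠ ⊥)
    (ψ : X.presheaf.stalk s →+* K) (hψ : Function.Injective ψ)
    (R : Subring K) [IsLocalRing R] (hR : ψ.range = R) (hRO : R ≤ O.toSubring)
    (hdom₀ : ∀ r, r ∈ maximalIdeal (X.presheaf.stalk s) ↔ O.valuation (ψ r) < 1)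
    {x : K} (hxR : x ∈ R) (hx1 : O.valuation x < 1)
    (hxmax : ∀ y ∈ R, O.valuation y < 1 → O.valuation y ≤ O.valuation x) :
    ∃ (x' : X') (ψ' : X'.presheaf.stalk x' →+* K), π x' = s ∧ Function.Injective ψ' ∧
      ψ'.range = locAtCentre (blowupRing R x) O := by
  classical
  have hdom : ∀ a : R, a ∈ maximalIdeal R ↔ O.valuation (a : K) < 1 :=
    mem_maximalIdeal_iff_of_range_eq O ψ hψ R hR hdom₀
  -- generators of `𝔪_s = J_s`
  obtain ⟨m, c, hc⟩ := exists_fin_span_eq_stalkIdeal J s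
  have hc' : Ideal.span (Set.range c) = maximalIdeal (X.presheaf.stalk s) := hc.trans hJ
  -- `ψ` as the restriction of `F : K(X) → K`
  let F : X.functionField →+* K := IsFractionRing.lift hψ
  have hFθ : F.comp (algebraMap (X.presheaf.stalk s) X.functionField) = ψ :=
    RingHom.ext fun a => IsFractionRing.lift_algebraMap hψ a
  -- `ψ` identifies `𝒪_{X,s}` with `R`, so it detects the maximal ideals
  have hRO' : ∀ r, ψ r ∈ O := fun r => hRO (hR ▸ ⟨r, rfl⟩)
  have hmemR : ∀ r, ψ r ∈ R := fun r => hR ▸ ⟨r, rfl⟩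
  have hdom' : ∀ r ∈ maximalIdeal (X.presheaf.stalk s), O.valuation (ψ r) < 1 := by
    intro r hr
    have hnu : ¬ IsUnit (⟨ψ r, hmemR r⟩ : R) := by
      intro hu
      apply (IsLocalRing.mem_maximalIdeal _).mp hr
      -- a unit of `R` comes from a unit of `𝒪_{X,s}`
      obtain ⟨v, hv⟩ := hu
      have hinv : ((↑v⁻¹ : R) : K) ∈ ψ.range := hR ▸ (↑v⁻¹ : R).2
      obtain ⟨t, ht⟩ := hinv
      have h1 : ψ (r * t) = 1 := by
        rw [map_mul, ht]
        have := congrArg (fun z : R => (z : K)) v.mul_inv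
        simp only [Subring.coe_mul, Subring.coe_one] at this
        rwa [hv] at this
      have h2 : r * t = 1 := hψ (by rw [h1, map_one])
      exact ⟨⟨r, t, h2, by rwa [mul_comm] at h2⟩, rfl⟩
    exact (hdom ⟨ψ r, hmemR r⟩).mp ((IsLocalRing.mem_maximalIdeal _).mpr hnu)
  -- a nonzero generator, and the generator `c j` of maximal value
  have hex : ∃ i, c i ≠ 0 := by
    by_contra h
    push Not at h
    apply hne
    rw [← hc', Ideal.span_eq_bot]
    rintro _ ⟨i, rfl⟩
    exact h i
  obtain ⟨i₀, hi₀⟩ := hex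
  haveI : Nonempty (Fin m) := ⟨i₀⟩
  obtain ⟨j, hj⟩ := Finite.exists_max fun i => O.valuation (ψ (c i))
  have hmin : ∀ i, O.valuation (ψ (c i)) ≤ O.valuation (ψ (c j)) := hj
  have hθ : ψ (c j) ≠ 0 := by
    intro h0
    have h1 : O.valuation (ψ (c i₀)) ≤ 0 := by simpa [h0] using hmin i₀
    have h2 : ψ (c i₀) = 0 := by simpa using h1
    exact hi₀ (hψ (by rw [h2, map_zero]))
  -- the chart at `c j` and the centre of `O` on it
  obtain ⟨q, hqiso, hsq⟩ := hπ.exists_chart_morphism_of_index s c hc j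
  let w : Spec (.of (chartRing c j)) := ⟨chartCentre c j ψ hθ O hRO' hmin, inferInstance⟩
  haveI := hqiso w
  -- the point `x' = q 𝔴` lies over `s`
  have hpt : Spec.map (CommRingCat.ofHom (chartBase c j)) w = closedPoint (X.presheaf.stalk s) :=
    PrimeSpectrum.ext (comap_reesChartBase_chartCentre c j ψ hθ O hRO' hmin hdom')
  have hs : π (q w) = s := by
    rw [← Scheme.Hom.comp_apply, hsq, Scheme.Hom.comp_apply, hpt]
    exact Scheme.fromSpecStalk_closedPoint
  have hrange := hπ.range_comp_stalkEmb_of_chart O (q w) s hs c hc' j F ψ hFθ hθ hRO' hmin R hR q w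
    rfl rfl hsq
  refine ⟨q w, F.comp (hπ.stalkEmb (q w)), hs, ?_, ?_⟩
  · exact F.injective.comp (hπ.stalkEmb_injective (q w))
  · rw [hrange]
    -- `θ(c_j)` and `x` both have the maximal value on `𝔪_R`
    have hcjm : c j ∈ maximalIdeal (X.presheaf.stalk s) :=
      hc' ▸ Ideal.subset_span (Set.mem_range_self j)
    have hvcj : O.valuation (ψ (c j)) < 1 := hdom' _ hcjm
    obtain ⟨r, rfl⟩ : x ∈ ψ.range := hR ▸ hxR
    have hrm : r ∈ maximalIdeal (X.presheaf.stalk s) := by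
      by_contra hru
      have hu : IsUnit r := by
        by_contra h; exact hru ((IsLocalRing.mem_maximalIdeal _).mpr h)
      have : O.valuation (ψ r) = 1 := by
        obtain ⟨v, rfl⟩ := hu
        apply le_antisymm ((O.valuation_le_one_iff _).mpr (hRO' _))
        have h1 : O.valuation (ψ (v : X.presheaf.stalk s)) * O.valuation (ψ (↑v⁻¹ : X.presheaf.stalk s)) = 1 := by
          rw [← map_mul, ← map_mul, Units.mul_inv, map_one, map_one]
        have h2 : O.valuation (ψ (↑v⁻¹ : X.presheaf.stalk s)) ≤ 1 := (O.valuation_le_one_iff _).mpr (hRO' _)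
        by_contra hlt
        push Not at hlt
        have : O.valuation (ψ ↑v) * O.valuation (ψ ↑v⁻¹) < 1 * 1 :=
          mul_lt_mul_of_lt_of_le_of_nonneg_of_pos hlt h2 zero_le zero_lt_one
        rw [h1, one_mul] at this
        exact lt_irrefl _ this
      exact (lt_irrefl _ (this ▸ hx1))
    have hx0 : ψ r ≠ 0 := by
      intro h0
      have h1 : O.valuation (ψ (c j)) ≤ O.valuation (ψ r) := hxmax _ (hmemR _) hvcj
      rw [h0, map_zero, le_zero_iff] at h1
      exact hθ ((map_eq_zero _).mp h1)
    have hle : O.valuation (ψ r) ≤ O.valuation (ψ (c j)) :=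
      valuation_le_of_mem_span O ψ hRO' c j hmin (hc'.symm ▸ hrm)
    have hveq : O.valuation (ψ (c j)) = O.valuation (ψ r) :=
      le_antisymm (hxmax _ (hmemR _) hvcj) hle
    exact locAtCentre_blowupRing_eq_of_valuation_eq O (hmemR (c j)) (hmemR r)
      ((hdom ⟨_, hmemR (c j)⟩).mpr hvcj) ((hdom ⟨_, hmemR r⟩).mpr hx1) hθ hx0 hveq

end BlowupHalf

/-! ## §3 The normalization half: the local ring of the normalization at the centre of a valuation -/

section NormalizationHalf

variable {K : Type u} [Field K] (O : ValuationSubring K)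

/-- Integrality over the image of a ring homomorphism `φ : A → K` is an integral dependence
relation with coefficients from `A`. [folklore] -/
private theorem isIntegral_range_iff {A : Type*} [CommRing A] (φ : A →+* K) (z : K) :
    IsIntegral φ.range z ↔ ∃ p : Polynomial A, p.Monic ∧ Polynomial.eval₂ φ z p = 0 := by
  have hcomp : (algebraMap φ.range K).comp φ.rangeRestrict = φ := RingHom.ext fun _ => rfl
  constructor
  · rintro ⟨p, hp, hpz⟩
    have hsurj : Function.Surjective φ.rangeRestrict := φ.rangeRestrict_surjective
    obtain ⟨q, hq, -, hqm⟩ := Polynomial.lifts_and_degree_eq_and_monic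
      (Polynomial.mem_lifts_of_surjective hsurj p) hp
    refine ⟨q, hqm, ?_⟩
    rw [← hcomp, ← Polynomial.eval₂_map, hq, hpz]
  · rintro ⟨p, hp, hpz⟩
    refine ⟨p.map φ.rangeRestrict, hp.map _, ?_⟩
    rw [Polynomial.eval₂_map, hcomp, hpz]

/-- Integrality over the valuation ring `O` is integrality over its underlying subring. [folklore] -/
private theorem isIntegral_valuationSubring_iff (z : K) : IsIntegral O z ↔ IsIntegral O.toSubring z := by
  constructor
  · rintro ⟨p, hp, hpz⟩
    let e : O →+* O.toSubring :=
      { toFun := fun x => ⟨x.1, x.2⟩, map_one' := rfl, map_mul' := fun _ _ => rfl,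
        map_zero' := rfl, map_add' := fun _ _ => rfl }
    refine ⟨p.map e, hp.map _, ?_⟩
    rw [Polynomial.eval₂_map]
    have : (algebraMap O.toSubring K).comp e = algebraMap O K := RingHom.ext fun _ => rfl
    rw [this, hpz]
  · rintro ⟨p, hp, hpz⟩
    let e : O.toSubring →+* O :=
      { toFun := fun x => ⟨x.1, x.2⟩, map_one' := rfl, map_mul' := fun _ _ => rfl,
        map_zero' := rfl, map_add' := fun _ _ => rfl }
    refine ⟨p.map e, hp.map _, ?_⟩
    rw [Polynomial.eval₂_map]
    have : (algebraMap O K).comp e = algebraMap O.toSubring K := RingHom.ext fun _ => rfl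
    rw [this, hpz]

/-- An element of `K` integral over a subring of the valuation ring `O` lies in `O`. [folklore] -/
private theorem mem_valuationSubring_of_isIntegral_of_subring_le {B : Subring K} (hB : B ≤ O.toSubring) {z : K}
    (hz : IsIntegral B z) : z ∈ O := by
  have hz' : IsIntegral O z :=
    (isIntegral_valuationSubring_iff O z).mpr (isIntegral_of_subring_le_subring hB hz)
  obtain ⟨w, hw⟩ := (isIntegrallyClosed_iff K).mp (inferInstance : IsIntegrallyClosed O) hz'
  rw [← hw]
  exact w.2

variable {Y : Scheme.{u}} [IsIntegral Y]

set_option maxHeartbeats 800000 in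
-- bookkeeping with the sections of the normalization over an affine open
/-- **The normalization half of the dictionary.** Let `Y` be an integral scheme, `y ∈ Y`, and
`ψ : 𝒪_{Y,y} ↪ K` an embedding onto a subring `R ⊆ O` dominated by the valuation ring `O` of
`K`, with `Frac R = K`. Then some point `y'` of the normalization `Y^ν` has local ring embedding
into `K` with image `(IC_K R)_{𝔪_O ∩ IC_K R}`, the localisation at the centre of `O` of the
integral closure of `R` in `K` (over an affine open `U = Spec A ∋ y`, `Y^ν` is `Spec` of the
integral closure `A'` of `A` in `K(Y)`, `y'` is the centre of `O` on `A'`, and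
`𝒪_{Y^ν,y'} = A'_{𝔪_O ∩ A'}`). [cite: Liu2002, Def. 4.1.24 and Prop. 4.1.22, p. 120–121] -/
theorem exists_point_normalization_range_eq (y : Y) (ψ : Y.presheaf.stalk y →+* K)
    (hψ : Function.Injective ψ) (R : Subring K) (hR : ψ.range = R) (hRO : R ≤ O.toSubring)
    (hdom : ∀ r, r ∈ maximalIdeal (Y.presheaf.stalk y) ↔ O.valuation (ψ r) < 1)
    (hfrac : ∀ z : K, ∃ a b : Y.presheaf.stalk y, z = ψ a / ψ b) :
    ∃ (y' : normalization Y) (ψ' : (normalization Y).presheaf.stalk y' →+* K),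
      Function.Injective ψ' ∧ ψ'.range = locAtCentre (integralClosure R K).toSubring O := by
  classical
  -- an affine open `U = Spec A ∋ y` and the sections `S ≅ K(Y)` of `Spec K(Y)` over it
  obtain ⟨_, ⟨U, hU, rfl⟩, hyU, -⟩ :=
    Y.isBasis_affineOpens.exists_subset_of_mem_open (Set.mem_univ y) isOpen_univ
  haveI : Nonempty U := ⟨⟨y, hyU⟩⟩
  letI := ((fromSpecFunctionField Y).app U).hom.toAlgebra
  -- `A = Γ(Y, U)`, `S = Γ(Spec K(Y), ξ⁻¹ U) ≅ K(Y)`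
  let e := functionFieldAlgEquivSections (X := Y) U
  -- the affine open `V = ν⁻¹ U = Spec A'` of `Y^ν`, `A' ≅ integralClosure A S`
  have hV : IsAffineOpen (normalizationι Y ⁻¹ᵁ U) := hU.preimage (normalizationι Y)
  let e₂ := (fromSpecFunctionField Y).normalizationObjIso hU
  have he₂ : ∀ z, e₂.hom.hom (e₂.inv.hom z) = z := fun z => by
    rw [← CommRingCat.comp_apply, e₂.inv_hom_id, CommRingCat.id_apply]
  -- `ψ` extended to `F : K(Y) → K`, and the embedding `Ψ : A' → K`
  let F : Y.functionField →+* K := IsFractionRing.lift hψ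
  have hFψ : ∀ a, F (algebraMap (Y.presheaf.stalk y) Y.functionField a) = ψ a :=
    fun a => IsFractionRing.lift_algebraMap hψ a
  let Ψ : Γ(normalization Y, normalizationι Y ⁻¹ᵁ U) →+* K :=
    F.comp ((e.symm : Γ(Spec Y.functionField, fromSpecFunctionField Y ⁻¹ᵁ U) →ₐ[Γ(Y, U)]
      Y.functionField).toRingHom.comp ((integralClosure Γ(Y, U)
        Γ(Spec Y.functionField, fromSpecFunctionField Y ⁻¹ᵁ U)).val.toRingHom.comp e₂.hom.hom))
  have hΨ_apply : ∀ t, Ψ t = F (e.symm ((e₂.hom.hom t : integralClosure Γ(Y, U)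
      Γ(Spec Y.functionField, fromSpecFunctionField Y ⁻¹ᵁ U)) : _)) := fun t => rfl
  -- `Ψ ∘ ν^* = ψ ∘ germ` on `A`
  letI := Y.presheaf.algebra_section_stalk (⟨y, hyU⟩ : U)
  haveI := functionField_isScalarTower Y U ⟨y, hyU⟩
  let φ : Γ(Y, U) →+* K := ψ.comp (Y.presheaf.germ U y hyU).hom
  have hφF : ∀ a : Γ(Y, U), F (algebraMap Γ(Y, U) Y.functionField a) = φ a := by
    intro a
    have h1 : algebraMap Γ(Y, U) Y.functionField a = algebraMap (Y.presheaf.stalk y) Y.functionField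
        (algebraMap Γ(Y, U) (Y.presheaf.stalk ((⟨y, hyU⟩ : U) : Y)) a) :=
      IsScalarTower.algebraMap_apply Γ(Y, U) (Y.presheaf.stalk ((⟨y, hyU⟩ : U) : Y)) Y.functionField a
    rw [h1, hFψ, TopCat.Presheaf.stalk_open_algebraMap]
    rfl
  have he₂ν : ∀ a : Γ(Y, U), e₂.hom.hom (((normalizationι Y).app U).hom a) =
      algebraMap Γ(Y, U) (integralClosure Γ(Y, U) Γ(Spec Y.functionField, fromSpecFunctionField Y ⁻¹ᵁ U)) a := by
    intro a
    have h := (fromSpecFunctionField Y).fromNormalization_app hU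
    change e₂.hom.hom (((fromSpecFunctionField Y).fromNormalization.app U).hom a) = _
    rw [h]
    exact he₂ _
  have hΨν : ∀ a : Γ(Y, U), Ψ (((normalizationι Y).app U).hom a) = φ a := by
    intro a
    rw [hΨ_apply, he₂ν]
    change F (e.symm (algebraMap Γ(Y, U) Γ(Spec Y.functionField, fromSpecFunctionField Y ⁻¹ᵁ U) a)) = φ a
    rw [AlgEquiv.commutes, hφF]
  have hφR : φ.range ≤ R := by
    rintro _ ⟨a, rfl⟩
    exact hR ▸ ⟨_, rfl⟩
  have hφO : φ.range ≤ O.toSubring := hφR.trans hRO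
  have hgφ : (F.comp (e.symm : Γ(Spec Y.functionField, fromSpecFunctionField Y ⁻¹ᵁ U) →ₐ[Γ(Y, U)]
      Y.functionField).toRingHom).comp (algebraMap Γ(Y, U) Γ(Spec Y.functionField, fromSpecFunctionField Y ⁻¹ᵁ U)) = φ := by
    refine RingHom.ext fun a => ?_
    change F (e.symm (algebraMap Γ(Y, U) Γ(Spec Y.functionField, fromSpecFunctionField Y ⁻¹ᵁ U) a)) = φ a
    rw [AlgEquiv.commutes, hφF]
  have hFφ : F.comp (algebraMap Γ(Y, U) Y.functionField) = φ := RingHom.ext fun a => hφF a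
  -- the image of `Ψ` is the integral closure of `φ(A)` in `K`
  have hΨrange : Ψ.range = (integralClosure φ.range K).toSubring := by
    ext z
    constructor
    · rintro ⟨t, rfl⟩
      rw [hΨ_apply]
      set w := e₂.hom.hom t with hw
      obtain ⟨p, hp, hpw⟩ : IsIntegral Γ(Y, U) (w : Γ(Spec Y.functionField, fromSpecFunctionField Y ⁻¹ᵁ U)) := w.2
      change IsIntegral φ.range _
      rw [isIntegral_range_iff]
      refine ⟨p, hp, ?_⟩
      have h := Polynomial.hom_eval₂ p (algebraMap Γ(Y, U) Γ(Spec Y.functionField, fromSpecFunctionField Y ⁻¹ᵁ U))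
        (F.comp (e.symm : Γ(Spec Y.functionField, fromSpecFunctionField Y ⁻¹ᵁ U) →ₐ[Γ(Y, U)]
          Y.functionField).toRingHom) (w : Γ(Spec Y.functionField, fromSpecFunctionField Y ⁻¹ᵁ U))
      rw [hpw, map_zero, hgφ] at h
      exact h.symm
    · intro hz
      change IsIntegral φ.range z at hz
      rw [isIntegral_range_iff] at hz
      obtain ⟨p, hp, hpz⟩ := hz
      obtain ⟨a, b, rfl⟩ := hfrac z
      set t₀ : Y.functionField := algebraMap (Y.presheaf.stalk y) Y.functionField a /
        algebraMap (Y.presheaf.stalk y) Y.functionField b with ht₀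
      have hzt : ψ a / ψ b = F t₀ := by rw [ht₀, map_div₀, hFψ, hFψ]
      have ht : IsIntegral Γ(Y, U) t₀ := by
        refine ⟨p, hp, F.injective ?_⟩
        rw [Polynomial.hom_eval₂, hFφ, ← hzt, hpz, map_zero]
      have het : IsIntegral Γ(Y, U) (e t₀) := ht.map e
      refine ⟨e₂.inv.hom ⟨e t₀, het⟩, ?_⟩
      rw [hΨ_apply, he₂, hzt]
      change F (e.symm (e t₀)) = F t₀
      rw [AlgEquiv.symm_apply_apply]
  -- `Ψ` takes values in `O`
  have hΨO : ∀ t, Ψ t ∈ O := fun t =>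
    mem_valuationSubring_of_isIntegral_of_subring_le O hφO (show Ψ t ∈ (integralClosure φ.range K).toSubring from hΨrange ▸ ⟨t, rfl⟩)
  -- the centre `𝔮` of `O` on `A'` and the point `y'` of `V` it defines
  let ΨO : Γ(normalization Y, normalizationι Y ⁻¹ᵁ U) →+* O := Ψ.codRestrict O.toSubring hΨO
  obtain ⟨q, hq⟩ : ∃ q : PrimeSpectrum Γ(normalization Y, normalizationι Y ⁻¹ᵁ U),
      q.asIdeal = (maximalIdeal O).comap ΨO := ⟨⟨_, Ideal.comap_isPrime _ _⟩, rfl⟩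
  have hmemq : ∀ t, t ∈ q.asIdeal ↔ O.valuation (Ψ t) < 1 := by
    intro t
    rw [hq, Ideal.mem_comap, ValuationSubring.valuation_lt_one_iff]
    rfl
  have hnotq : ∀ t, t ∉ q.asIdeal ↔ O.valuation (Ψ t) = 1 := by
    intro t
    rw [hmemq, not_lt]
    exact ⟨fun h => le_antisymm ((O.valuation_le_one_iff _).mpr (hΨO t)) h, fun h => h.ge⟩
  let y' : normalization Y := hV.fromSpec q
  have hy'V : y' ∈ normalizationι Y ⁻¹ᵁ U := by
    have h : hV.fromSpec q ∈ Set.range hV.fromSpec := ⟨q, rfl⟩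
    rw [hV.range_fromSpec] at h
    exact h
  have hpq : hV.primeIdealOf ⟨y', hy'V⟩ = q := by
    apply hV.fromSpec.isOpenEmbedding.injective
    rw [IsAffineOpen.fromSpec_primeIdealOf]
  -- the stalk at `y'` is the localization of `A'` at `𝔮`
  letI := (normalization Y).presheaf.algebra_section_stalk (⟨y', hy'V⟩ : ↥(normalizationι Y ⁻¹ᵁ U))
  have hloc : IsLocalization.AtPrime ((normalization Y).presheaf.stalk y') q.asIdeal := by
    have h := hV.isLocalization_stalk ⟨y', hy'V⟩
    rwa [hpq] at h
  have hunits : ∀ s : q.asIdeal.primeCompl, IsUnit (Ψ s) := fun s =>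
    isUnit_iff_ne_zero.mpr (ne_zero_of_valuation_eq_one ((hnotq s.1).mp s.2))
  let ψ' : (normalization Y).presheaf.stalk y' →+* K :=
    @IsLocalization.lift _ _ q.asIdeal.primeCompl _ _ _ _ _ hloc Ψ hunits
  have hψ'mk : ∀ (a : Γ(normalization Y, normalizationι Y ⁻¹ᵁ U)) (s : q.asIdeal.primeCompl),
      ψ' (IsLocalization.mk' _ a s) = Ψ a / Ψ s := by
    intro a s
    have hs0 : Ψ s ≠ 0 := ne_zero_of_valuation_eq_one ((hnotq s.1).mp s.2)
    rw [eq_div_iff hs0]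
    have h1 : ψ' (algebraMap _ _ (s : Γ(normalization Y, normalizationι Y ⁻¹ᵁ U))) = Ψ s :=
      @IsLocalization.lift_eq _ _ q.asIdeal.primeCompl _ _ _ _ _ hloc Ψ hunits _
    have h2 : ψ' (algebraMap _ _ a) = Ψ a :=
      @IsLocalization.lift_eq _ _ q.asIdeal.primeCompl _ _ _ _ _ hloc Ψ hunits _
    rw [← h1, ← map_mul, IsLocalization.mk'_spec, h2]
  have hΨinj : Function.Injective Ψ := by
    intro a b h
    rw [hΨ_apply, hΨ_apply] at h
    have h1 := Subtype.val_injective (e.symm.injective (F.injective h))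
    have h2 := congrArg e₂.inv.hom h1
    rwa [← CommRingCat.comp_apply, ← CommRingCat.comp_apply, e₂.hom_inv_id,
      CommRingCat.id_apply, CommRingCat.id_apply] at h2
  -- `φ` is `ψ` on germs
  have hφψ : ∀ a : Γ(Y, U), φ a = ψ (algebraMap Γ(Y, U) (Y.presheaf.stalk ((⟨y, hyU⟩ : U) : Y)) a) := by
    intro a
    rw [TopCat.Presheaf.stalk_open_algebraMap]
    rfl
  -- `R = ψ(𝒪_{Y,y})` is the localisation of `φ(A)` at the centre of `O`
  have hR' : R = locAtCentre φ.range O := by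
    rw [← hR]
    haveI := hU.isLocalization_stalk ⟨y, hyU⟩
    ext z
    constructor
    · rintro ⟨t, rfl⟩
      obtain ⟨x, hx⟩ :=
        IsLocalization.mk'_surjective (hU.primeIdealOf ⟨y, hyU⟩).asIdeal.primeCompl t
      obtain ⟨a, s⟩ := x
      simp only at hx
      have hsu : IsUnit (algebraMap Γ(Y, U) (Y.presheaf.stalk ((⟨y, hyU⟩ : U) : Y)) (s : Γ(Y, U))) :=
        IsLocalization.map_units _ s
      have hvs : O.valuation (φ s) = 1 := by
        have hns : algebraMap Γ(Y, U) (Y.presheaf.stalk ((⟨y, hyU⟩ : U) : Y)) (s : Γ(Y, U)) ∉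
            maximalIdeal _ := fun h => (mem_nonunits_iff.mp ((IsLocalRing.mem_maximalIdeal _).mp h)) hsu
        rw [hdom, ← hφψ, not_lt] at hns
        exact le_antisymm ((O.valuation_le_one_iff _).mpr (hφO ⟨_, rfl⟩)) hns
      refine ⟨φ a, ⟨a, rfl⟩, φ s, ⟨s, rfl⟩, hvs, ?_⟩
      rw [← hx, eq_div_iff (ne_zero_of_valuation_eq_one hvs), hφψ, hφψ, ← map_mul,
        IsLocalization.mk'_spec]
    · rintro ⟨_, ⟨a, rfl⟩, _, ⟨s, rfl⟩, hvs, rfl⟩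
      have hsu : IsUnit ((Y.presheaf.germ U y hyU).hom s) := by
        by_contra h
        have hm : (Y.presheaf.germ U y hyU).hom s ∈ maximalIdeal _ :=
          (IsLocalRing.mem_maximalIdeal _).mpr (mem_nonunits_iff.mpr h)
        have hlt := (hdom _).mp hm
        exact lt_irrefl _ (hvs ▸ hlt)
      obtain ⟨v, hv⟩ := hsu
      refine ⟨(Y.presheaf.germ U y hyU).hom a * ↑v⁻¹, ?_⟩
      rw [map_mul, eq_div_iff (ne_zero_of_valuation_eq_one hvs)]
      change ψ _ * ψ ↑v⁻¹ * ψ ((Y.presheaf.germ U y hyU).hom s) = ψ _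
      rw [mul_assoc, ← map_mul, ← hv, Units.inv_mul, map_one, mul_one]
  refine ⟨y', ψ', ?_, ?_⟩
  · -- injectivity: `A'` embeds into `K`
    refine (injective_iff_map_eq_zero _).mpr fun t ht => ?_
    obtain ⟨x, hx⟩ := IsLocalization.mk'_surjective q.asIdeal.primeCompl t
    obtain ⟨a, s⟩ := x
    simp only at hx
    rw [← hx, hψ'mk, div_eq_zero_iff] at ht
    rcases ht with ha | hs
    · have : a = 0 := hΨinj (by rw [ha, map_zero])
      rw [← hx, this, IsLocalization.mk'_zero]
    · exact absurd hs (ne_zero_of_valuation_eq_one ((hnotq s.1).mp s.2))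
  · -- the image
    rw [hR', locAtCentre_integralClosure_locAtCentre O hφO, ← hΨrange]
    ext z
    constructor
    · rintro ⟨t, rfl⟩
      obtain ⟨x, hx⟩ := IsLocalization.mk'_surjective q.asIdeal.primeCompl t
      obtain ⟨a, s⟩ := x
      simp only at hx
      rw [← hx, hψ'mk]
      exact ⟨Ψ a, ⟨a, rfl⟩, Ψ s, ⟨s, rfl⟩, (hnotq s.1).mp s.2, rfl⟩
    · rintro ⟨_, ⟨a, rfl⟩, _, ⟨s, rfl⟩, hvs, rfl⟩
      have hs : s ∉ q.asIdeal := (hnotq s).mpr hvs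
      exact ⟨IsLocalization.mk' _ a ⟨s, hs⟩, hψ'mk a ⟨s, hs⟩⟩

end NormalizationHalf

/-! ## §4 The initial model: a normal local essentially-finite-type `k`-algebra is a local ring of a normal surface -/

section InitialModel

variable {k K : Type u} [Field k] [Field K] [Algebra k K] (O : ValuationSubring K)

/-- Integrality over a `k`-subalgebra passes to larger `k`-subalgebras. [folklore] -/
private theorem isIntegral_of_subalgebra_le_subalgebra {A B : Subalgebra k K} (h : A ≤ B) {z : K}
    (hz : IsIntegral A z) : IsIntegral B z := by
  obtain ⟨p, hp, hpz⟩ := hz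
  refine ⟨p.map (Subalgebra.inclusion h).toRingHom, hp.map _, ?_⟩
  rw [Polynomial.eval₂_map]
  have : (algebraMap B K).comp (Subalgebra.inclusion h).toRingHom = algebraMap A K :=
    RingHom.ext fun _ => rfl
  rw [this, hpz]

set_option maxHeartbeats 800000 in
-- the affine model carries a dozen structures
/-- **The initial model.** A normal local `k`-algebra `R₀ ⊆ O`, essentially of finite type with
fraction field `K` (`tr.deg_k K = 2`) and equal to its localisation at the centre of `O`, is the
local ring of an (affine) normal surface over `k` at a point: `R₀ = A'_{𝔪_O ∩ A'}` for the
integral closure `A'` in `K` of a finitely generated `k`-subalgebra `A₀` of which `R₀` is a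
localisation (`A'` is finitely generated by E. Noether's finiteness, of dimension `tr.deg_k K = 2`
by the dimension theorem for affine domains). [cite: Liu2002, Prop. 4.1.27 and Cor. 4.1.30, p. 122]
[cite: Matsumura1987, Thm. 5.6] -/
theorem exists_normalSurface_point_range_eq (R₀ : Subalgebra k K)
    (htr : Algebra.trdeg k K = 2) (hess : Algebra.EssFiniteType k R₀) (hfrac : IsFractionRing R₀ K)
    (hRO : R₀.toSubring ≤ O.toSubring)
    (hloc : Algebra.adjoin k {y : K | ∃ a ∈ R₀, ∃ s ∈ R₀, s⁻¹ ∈ O ∧ y = a * s⁻¹} = R₀)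
    (hnorm : IsIntegrallyClosed R₀) :
    ∃ (S : NormalSurface k) (P : S.X) (ψ : S.X.presheaf.stalk P →+* K),
      Function.Injective ψ ∧ ψ.range = R₀.toSubring := by
  classical
  haveI := hfrac
  -- `R₀` is closed under fractions with denominators of value `1`
  have hlocR : ∀ a ∈ R₀, ∀ s ∈ R₀, O.valuation s = 1 → a / s ∈ R₀ := by
    intro a ha s hs hvs
    rw [← hloc, div_eq_mul_inv]
    refine Algebra.subset_adjoin ⟨a, ha, s, hs, ?_, rfl⟩
    rw [← O.valuation_le_one_iff, map_inv₀, hvs, inv_one]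
  -- `R₀` is a localisation of a finitely generated subalgebra `A₀`
  obtain ⟨s, hs⟩ := hess.cond
  set M := (IsUnit.submonoid R₀).comap (algebraMap (Algebra.adjoin k (s : Set R₀)) R₀) with hM
  haveI := hs
  let A₀ : Subalgebra k K := (Algebra.adjoin k (s : Set R₀)).map R₀.val
  have hA₀R : A₀ ≤ R₀ := by
    rintro _ ⟨a, -, rfl⟩
    exact a.2
  have hA₀fg : A₀.FG := (Subalgebra.fg_adjoin_finset s).map _
  -- every element of `R₀` is `a / t` with `a, t ∈ A₀`, `ν(t) = 0`
  have hrepr : ∀ r ∈ R₀, ∃ a ∈ A₀, ∃ t ∈ A₀, O.valuation t = 1 ∧ r = a / t := by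
    intro r hr
    obtain ⟨⟨a, t⟩, h⟩ := IsLocalization.mk'_surjective M (⟨r, hr⟩ : R₀)
    simp only at h
    have ht : IsUnit ((t : Algebra.adjoin k (s : Set R₀)) : R₀) := t.2
    have ht0 : ((t : Algebra.adjoin k (s : Set R₀)) : R₀) ≠ 0 := ht.ne_zero
    have ht0' : (((t : Algebra.adjoin k (s : Set R₀)) : R₀) : K) ≠ 0 := fun h0 =>
      ht0 (Subtype.ext h0)
    have hvt : O.valuation (((t : Algebra.adjoin k (s : Set R₀)) : R₀) : K) = 1 := by
      refine valuation_eq_one_of_inv_mem_valuationSubring O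
        (hRO ((t : Algebra.adjoin k (s : Set R₀)) : R₀).2) ?_ ht0'
      obtain ⟨u, hu⟩ := ht
      have hmul : ((↑u⁻¹ : R₀) : K) * (((t : Algebra.adjoin k (s : Set R₀)) : R₀) : K) = 1 := by
        rw [← hu, ← Subalgebra.coe_mul, Units.inv_mul, Subalgebra.coe_one]
      rw [inv_eq_of_mul_eq_one_left hmul]
      exact hRO (↑u⁻¹ : R₀).2
    have hspec := IsLocalization.mk'_spec (S := R₀) a t
    rw [h] at hspec
    have hK := congrArg (fun z : R₀ => (z : K)) hspec
    simp only [Subalgebra.coe_mul] at hK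
    refine ⟨((a : R₀) : K), ⟨(a : R₀), a.2, rfl⟩, (((t : Algebra.adjoin k (s : Set R₀)) : R₀) : K),
      ⟨((t : Algebra.adjoin k (s : Set R₀)) : R₀), (t : Algebra.adjoin k (s : Set R₀)).2, rfl⟩,
      hvt, ?_⟩
    rw [eq_div_iff ht0']
    exact hK
  -- the integral closure `A'` of `A₀` in `K`: `A₀ ⊆ A' ⊆ R₀` and `R₀ = A'_{𝔪_O ∩ A'}`
  let A' : Subalgebra A₀ K := integralClosure A₀ K
  have hA₀A' : ∀ x ∈ A₀, x ∈ A' := fun x hx =>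
    isIntegral_algebraMap (R := A₀) (A := K) (x := (⟨x, hx⟩ : A₀))
  have hA'R : ∀ x ∈ A', x ∈ R₀ := by
    intro x hx
    have hx' : IsIntegral R₀ x := isIntegral_of_subalgebra_le_subalgebra hA₀R hx
    obtain ⟨y, hy⟩ := (isIntegrallyClosed_iff K).mp hnorm hx'
    rw [← hy]
    exact y.2
  have hA'O : A'.toSubring ≤ O.toSubring := fun x hx => hRO (hA'R x hx)
  have hR₀ : R₀.toSubring = locAtCentre A'.toSubring O := by
    ext r
    constructor
    · intro hr
      obtain ⟨a, ha, t, ht, hvt, rfl⟩ := hrepr r hr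
      exact ⟨a, hA₀A' a ha, t, hA₀A' t ht, hvt, rfl⟩
    · rintro ⟨a, ha, t, ht, hvt, rfl⟩
      exact hlocR a (hA'R a ha) t (hA'R t ht) hvt
  -- `A₀` has fraction field `K`; `A'` is finite over `A₀` (E. Noether), so of finite type over `k`
  haveI : Algebra.FiniteType k A₀ := A₀.fg_iff_finiteType.mp hA₀fg
  haveI : FaithfulSMul A₀ K := (faithfulSMul_iff_algebraMap_injective A₀ K).mpr Subtype.val_injective
  haveI : IsFractionRing A₀ K := by
    refine IsFractionRing.of_field A₀ K fun z => ?_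
    obtain ⟨x, y, -, rfl⟩ := IsFractionRing.div_surjective (A := R₀) z
    obtain ⟨a, ha, t, ht, hvt, hx⟩ := hrepr _ x.2
    obtain ⟨a', ha', t', ht', hvt', hy⟩ := hrepr _ y.2
    refine ⟨⟨a * t', A₀.mul_mem ha ht'⟩, ⟨a' * t, A₀.mul_mem ha' ht⟩, ?_⟩
    change (x : K) / (y : K) = (a * t') / (a' * t)
    rw [hx, hy]
    have := ne_zero_of_valuation_eq_one hvt
    have := ne_zero_of_valuation_eq_one hvt'
    rw [div_div_div_eq, mul_comm t a']
  haveI : Module.Finite A₀ A' := NoetherFiniteIntegralClosure_holds.self k A₀ K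
  haveI : Algebra.FiniteType k A' :=
    Algebra.FiniteType.trans (inferInstance : Algebra.FiniteType k A₀) (Module.Finite.finiteType A')
  haveI : IsFractionRing A' K := integralClosure.isFractionRing_of_finite_extension K K
  haveI : IsIntegrallyClosed A' := (isIntegrallyClosed_iff_isIntegrallyClosedIn K).mpr inferInstance
  -- `dim A' = tr.deg_k K = 2`
  have hdimA' : ringKrullDim A' = 2 := by
    obtain ⟨n, hn, htr'⟩ := exists_ringKrullDim_eq_and_trdeg_eq k A'
    haveI : Algebra.IsAlgebraic A' K := IsLocalization.isAlgebraic K (nonZeroDivisors A')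
    have h2 : Algebra.trdeg k A' = 2 := by
      rw [← htr, ← trdeg_add_eq k A' (A := K), trdeg_eq_zero (R := A') (A := K),
        add_zero]
    rw [hn]
    rw [htr'] at h2
    exact_mod_cast h2
  -- the affine normal surface `Spec A'`
  let X : Scheme.{u} := Spec (.of A')
  haveI : LocallyOfFiniteType (Spec.map (CommRingCat.ofHom (algebraMap k A'))) :=
    HasRingHomProperty.Spec_iff.mpr (RingHom.finiteType_algebraMap.mpr inferInstance)
  let S : NormalSurface k :=
    { X := X
      hom := Spec.map (CommRingCat.ofHom (algebraMap k A'))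
      isSeparated := inferInstance
      locallyOfFiniteType := inferInstance
      quasiCompact := inferInstance
      isIntegral := inferInstance
      normal := fun x => by
        letI : Algebra A' (X.presheaf.stalk x) := StructureSheaf.stalkAlgebra A' x
        haveI : IsLocalization.AtPrime (X.presheaf.stalk x) x.asIdeal :=
          StructureSheaf.IsLocalization.to_stalk A' x
        exact isIntegrallyClosed_of_isLocalization (X.presheaf.stalk x) x.asIdeal.primeCompl
          (Ideal.primeCompl_le_nonZeroDivisors _)
      dim_eq := by
        change topologicalKrullDim (PrimeSpectrum A') = 2
        rw [PrimeSpectrum.topologicalKrullDim_eq_ringKrullDim, hdimA'] }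
  -- the centre `P` of `O` on `A'` and the embedding of `𝒪_{X,P} = A'_P` into `K`
  let toO : A' →+* O := (algebraMap A' K).codRestrict O.toSubring fun x => hA'O x.2
  let P : X := ⟨(maximalIdeal O).comap toO, Ideal.comap_isPrime _ _⟩
  have hmemP : ∀ x : A', x ∈ P.asIdeal ↔ O.valuation (x : K) < 1 := fun x => by
    change toO x ∈ maximalIdeal O ↔ _
    rw [ValuationSubring.valuation_lt_one_iff]
    rfl
  have hnotP : ∀ x : A', x ∉ P.asIdeal ↔ O.valuation (x : K) = 1 := fun x => by
    rw [hmemP, not_lt]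
    exact ⟨fun h => le_antisymm ((O.valuation_le_one_iff _).mpr (hA'O x.2)) h, fun h => h.ge⟩
  letI : Algebra A' (X.presheaf.stalk P) := StructureSheaf.stalkAlgebra A' P
  haveI hlocP : IsLocalization.AtPrime (X.presheaf.stalk P) P.asIdeal :=
    StructureSheaf.IsLocalization.to_stalk A' P
  have hunits : ∀ t : P.asIdeal.primeCompl, IsUnit (algebraMap A' K t) := fun t =>
    isUnit_iff_ne_zero.mpr (ne_zero_of_valuation_eq_one ((hnotP t.1).mp t.2))
  let ψ : X.presheaf.stalk P →+* K := IsLocalization.lift (M := P.asIdeal.primeCompl) hunits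
  have hψmk : ∀ (a : A') (t : P.asIdeal.primeCompl),
      ψ (IsLocalization.mk' _ a t) = (a : K) / (t : K) := by
    intro a t
    have ht0 : ((t : A') : K) ≠ 0 := ne_zero_of_valuation_eq_one ((hnotP t.1).mp t.2)
    rw [eq_div_iff ht0]
    have h1 : ψ (algebraMap _ _ (t : A')) = (t : K) := IsLocalization.lift_eq hunits _
    have h2 : ψ (algebraMap _ _ a) = (a : K) := IsLocalization.lift_eq hunits _
    rw [← h1, ← map_mul, IsLocalization.mk'_spec, h2]
  refine ⟨S, P, ψ, ?_, ?_⟩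
  · refine (injective_iff_map_eq_zero _).mpr fun z hz => ?_
    obtain ⟨x, hx⟩ := IsLocalization.mk'_surjective P.asIdeal.primeCompl z
    obtain ⟨a, t⟩ := x
    simp only at hx
    rw [← hx, hψmk, div_eq_zero_iff] at hz
    rcases hz with ha | ht
    · have : a = 0 := Subtype.ext ha
      rw [← hx, this, IsLocalization.mk'_zero]
    · exact absurd ht (ne_zero_of_valuation_eq_one ((hnotP t.1).mp t.2))
  · rw [hR₀]
    ext z
    constructor
    · rintro ⟨w, rfl⟩
      obtain ⟨x, hx⟩ := IsLocalization.mk'_surjective P.asIdeal.primeCompl w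
      obtain ⟨a, t⟩ := x
      simp only at hx
      rw [← hx, hψmk]
      exact ⟨a, a.2, (t : A'), (t : A').2, (hnotP t.1).mp t.2, rfl⟩
    · rintro ⟨a, ha, t, ht, hvt, rfl⟩
      have ht' : (⟨t, ht⟩ : A') ∉ P.asIdeal := (hnotP _).mpr hvt
      exact ⟨IsLocalization.mk' _ (⟨a, ha⟩ : A') ⟨⟨t, ht⟩, ht'⟩, hψmk ⟨a, ha⟩ ⟨⟨t, ht⟩, ht'⟩⟩

end InitialModel

/-! ## §5 Assembly: Lipman's sequence along a valuation, and the reduction -/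

section Assembly

open Scheme.IdealSheafData

variable {k K : Type u} [Field k] [Field K] [Algebra k K] (O : ValuationSubring K)

/-- A Noetherian normal local domain with zero maximal ideal (a field) is regular. [folklore] -/
private theorem isRegularLocalRing_of_maximalIdeal_eq_bot {A : Type*} [CommRing A] [IsDomain A]
    [IsLocalRing A] [IsNoetherianRing A] [IsIntegrallyClosed A] (h : maximalIdeal A = ⊥) :
    IsRegularLocalRing A := by
  refine isRegularLocalRing_of_isIntegrallyClosed_of_ringKrullDim_le_one A ?_
  have hF : IsField A := IsLocalRing.isField_iff_maximalIdeal_eq.mpr h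
  letI := hF.toField
  rw [ringKrullDim_eq_zero_of_field A]
  exact zero_le_one

omit [Algebra k K] in
/-- **One step of Lipman's sequence along a valuation** (the local dictionary): if the local ring
of the normal surface `X` at a (singular) point `P` embeds into `K` with image `R ⊆ O` dominated
by `O`, then for every `x ∈ 𝔪_R` of maximal value the local ring of `X₁ = (Bl_{Sing X} X)^ν` at
a suitable point embeds into `K` with image `(IC_K R[𝔪_R/x])_{𝔪_O}`, the normalised quadratic
transform of `R` along `O` — `P` is an isolated closed point of `Sing X`, so `Bl_{Sing X}` is
the blowing up of `𝔪_P` near `P` (`IsBlowup.exists_point_range_eq_locAtCentre_blowupRing`),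
followed by the normalization (`exists_point_normalization_range_eq`).
[cite: Liu2002, §8.3.4, Lemma 8.3.46 and Thm. 8.3.44, p. 362] -/
theorem NormalSurface.exists_point_step_range_eq (S : NormalSurface k) (P : S.X)
    (ψ : S.X.presheaf.stalk P →+* K) (hψ : Function.Injective ψ) (R : Subring K) [IsLocalRing R]
    (hR : ψ.range = R) (hRO : R ≤ O.toSubring)
    (hdom : ∀ r, r ∈ maximalIdeal (S.X.presheaf.stalk P) ↔ O.valuation (ψ r) < 1)
    (hfrac : ∀ z : K, ∃ a b : S.X.presheaf.stalk P, z = ψ a / ψ b)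
    (hreg : ¬ IsRegularLocalRing (S.X.presheaf.stalk P))
    {x : K} (hxR : x ∈ R) (hx1 : O.valuation x < 1)
    (hxmax : ∀ y ∈ R, O.valuation y < 1 → O.valuation y ≤ O.valuation x) :
    ∃ (P' : S.step.X) (ψ' : S.step.X.presheaf.stalk P' →+* K), Function.Injective ψ' ∧
      ψ'.range = locAtCentre (integralClosure (blowupRing R x) K).toSubring O := by
  haveI := S.isNoetherian_X
  -- `Sing X` is a finite set of closed points containing `P`, so `J_P = 𝔪_P`
  have hP : P ∈ (singularLocusClosed S.X S.hom : Set S.X) := fun h => hreg h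
  have hfin : ((singularLocusClosed S.X S.hom : Set S.X)).Finite :=
    finite_compl_regularLocus_of_normal_surface S.hom S.normal S.dim_eq.le
  have hcl : ∀ x ∈ (singularLocusClosed S.X S.hom : Set S.X), IsClosed ({x} : Set S.X) :=
    fun x hx => isClosed_singleton_of_not_mem_regularLocus S.normal S.dim_eq.le hx
  have hJ : stalkIdeal (singularLocusIdeal S.X S.hom) P = maximalIdeal (S.X.presheaf.stalk P) :=
    stalkIdeal_vanishingIdeal_of_finite hfin hcl hP
  -- `𝔪_P ≠ 0` (a field is regular)
  haveI := S.normal P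
  have hne : maximalIdeal (S.X.presheaf.stalk P) ≠ ⊥ := fun h =>
    hreg (isRegularLocalRing_of_maximalIdeal_eq_bot h)
  -- the blowing up
  obtain ⟨x', ψ₁, -, hψ₁, hrange₁⟩ := (blowup.isBlowup (singularLocusIdeal S.X S.hom))
    |>.exists_point_range_eq_locAtCentre_blowupRing O P hJ hne ψ hψ R hR hRO hdom hxR hx1 hxmax
  -- `x ≠ 0`, so `R[𝔪_R/x] ⊆ O`
  have hx0 : x ≠ 0 := by
    obtain ⟨r, hrm, hr0⟩ := Submodule.exists_mem_ne_zero_of_ne_bot hne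
    have hvr : O.valuation (ψ r) < 1 := (hdom r).mp hrm
    have hψr0 : ψ r ≠ 0 := fun h0 => hr0 (hψ (by rw [h0, map_zero]))
    intro h0
    have h1 := hxmax (ψ r) (hR ▸ ⟨r, rfl⟩) hvr
    rw [h0, map_zero, le_zero_iff] at h1
    exact hψr0 ((map_eq_zero _).mp h1)
  have hBO : blowupRing R x ≤ O.toSubring := by
    refine Subring.closure_le.mpr ?_
    rintro z (hz | ⟨y, hy, rfl⟩)
    · exact hRO hz
    · have hdomR : ∀ a : R, a ∈ maximalIdeal R ↔ O.valuation (a : K) < 1 :=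
        mem_maximalIdeal_iff_of_range_eq O ψ hψ R hR hdom
      have hvy := hxmax _ y.2 ((hdomR y).mp hy)
      change (y : K) / x ∈ O
      rw [← O.valuation_le_one_iff, map_div₀]
      exact div_le_one_of_le₀ hvy zero_le
  -- the normalization
  haveI : IsLocalRing (locAtCentre (blowupRing R x) O) := isLocalRing_locAtCentre hBO
  have hdom₁ : ∀ r, r ∈ maximalIdeal ((singBlowup S.X S.hom).presheaf.stalk x') ↔
      O.valuation (ψ₁ r) < 1 :=
    mem_maximalIdeal_iff_of_range_eq_locAtCentre O ψ₁ hψ₁ hBO hrange₁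
  have hfrac₁ : ∀ z : K, ∃ a b : (singBlowup S.X S.hom).presheaf.stalk x', z = ψ₁ a / ψ₁ b := by
    intro z
    obtain ⟨a, b, rfl⟩ := hfrac z
    have hsub : R ≤ ψ₁.range := hrange₁ ▸ (le_blowupRing R x).trans (le_locAtCentre _ O)
    have ha : ψ a ∈ R := hR ▸ ⟨a, rfl⟩
    have hb : ψ b ∈ R := hR ▸ ⟨b, rfl⟩
    obtain ⟨a', ha'⟩ := hsub ha
    obtain ⟨b', hb'⟩ := hsub hb
    exact ⟨a', b', by rw [ha', hb']⟩
  obtain ⟨y', ψ₂, hψ₂, hrange₂⟩ := exists_point_normalization_range_eq O x' ψ₁ hψ₁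
    (locAtCentre (blowupRing R x) O) hrange₁ (locAtCentre_le hBO) hdom₁ hfrac₁
  exact ⟨y', ψ₂, hψ₂, hrange₂.trans (locAtCentre_integralClosure_locAtCentre O hBO)⟩

/-- The normalised quadratic transform contains the ring it started from. [folklore] -/
private theorem le_locAtCentre_integralClosure_blowupRing (R : Subring K) [IsLocalRing R] (x : K) :
    R ≤ locAtCentre (integralClosure (blowupRing R x) K).toSubring O := fun z hz =>
  le_locAtCentre _ O (isIntegral_algebraMap (R := blowupRing R x) (A := K)
    (x := (⟨z, le_blowupRing R x hz⟩ : blowupRing R x)))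

/-- **Lipman's sequence along a valuation, `n` steps**: if the local ring of the normal surface
`X` at `P` embeds into `K` with image `R_m` (dominated by `O`, `Frac = K`), and the members
`R_m, R_{m+1}, …` of a sequence obeying the recursion of `Lipman1978ValuativeQuadraticSequence`
are all singular, then the local ring of `X_n = step^[n] X` at a suitable point embeds into `K`
with image `R_{m+n}`. [cite: Liu2002, §8.3.4, (3.11) and Thm. 8.3.44, p. 362] -/
theorem NormalSurface.exists_point_iterate_range_eq (R : ℕ → Subalgebra k K) (x : ℕ → K)
    (hsing : ∀ i, ¬ IsRegularLocalRing (R i))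
    (hstep : ∀ i : ℕ, ¬ IsRegularLocalRing ↥(R i) →
      x i ∈ R i ∧ O.valuation (x i) < 1 ∧
        (∀ y ∈ R i, O.valuation y < 1 → O.valuation y ≤ O.valuation (x i)) ∧
        R (i + 1) =
          Algebra.adjoin k {y : K | ∃ a ∈ Algebra.adjoin k {z : K | IsIntegral
              ↥(Algebra.adjoin k ((R i : Set K) ∪
                {w : K | ∃ a ∈ R i, O.valuation a < 1 ∧ w = a * (x i)⁻¹})) z},
            ∃ s ∈ Algebra.adjoin k {z : K | IsIntegral
              ↥(Algebra.adjoin k ((R i : Set K) ∪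
                {w : K | ∃ a ∈ R i, O.valuation a < 1 ∧ w = a * (x i)⁻¹})) z},
            s⁻¹ ∈ O ∧ y = a * s⁻¹}) (n : ℕ) :
    ∀ (m : ℕ) (S : NormalSurface k) (P : S.X) (ψ : S.X.presheaf.stalk P →+* K),
      Function.Injective ψ → ψ.range = (R m).toSubring → (R m).toSubring ≤ O.toSubring →
      (∀ r, r ∈ maximalIdeal (S.X.presheaf.stalk P) ↔ O.valuation (ψ r) < 1) →
      (∀ z : K, ∃ a b : S.X.presheaf.stalk P, z = ψ a / ψ b) →
      ∃ (P' : (NormalSurface.step^[n] S).X) (ψ' : (NormalSurface.step^[n] S).X.presheaf.stalk P' →+* K),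
        Function.Injective ψ' ∧ ψ'.range = (R (m + n)).toSubring := by
  induction n with
  | zero =>
    intro m S P ψ hψ hR _ _ _
    exact ⟨P, ψ, hψ, hR⟩
  | succ n ih =>
    intro m S P ψ hψ hR hRO hdom hfrac
    -- the data of the recursion at the singular stage `m`
    obtain ⟨hxR, hx1, hxmax, hRsucc⟩ := hstep m (hsing m)
    haveI : IsLocalRing (R m).toSubring := isLocalRing_of_range_eq ψ (R m).toSubring hR
    have hdomR : ∀ a : (R m).toSubring, a ∈ maximalIdeal (R m).toSubring ↔ O.valuation (a : K) < 1 :=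
      mem_maximalIdeal_iff_of_range_eq O ψ hψ _ hR hdom
    have hreg : ¬ IsRegularLocalRing (S.X.presheaf.stalk P) := fun h =>
      hsing m ((isRegularLocalRing_iff_of_range_eq ψ hψ (R m) hR).mp h)
    -- one step on the surface
    obtain ⟨P₁, ψ₁, hψ₁, hrange₁⟩ := S.exists_point_step_range_eq O P ψ hψ (R m).toSubring hR hRO
      hdom hfrac hreg hxR hx1 hxmax
    -- the image is `R (m + 1)`, by the three conversions
    have hB₁ : (Algebra.adjoin k ((R m : Set K) ∪
        {w : K | ∃ a ∈ R m, O.valuation a < 1 ∧ w = a * (x m)⁻¹})).toSubring =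
        blowupRing (R m).toSubring (x m) :=
      adjoin_union_toSubring_eq_blowupRing O (R m) hdomR (x m)
    have hBO : blowupRing (R m).toSubring (x m) ≤ O.toSubring := by
      -- `R[𝔪/x] ⊆ (IC R[𝔪/x])_{𝔪_O} = ψ₁(𝒪) `… read off the valuation: `ν(y) ≥ ν(x)` on `𝔪`
      refine Subring.closure_le.mpr ?_
      rintro z (hz | ⟨y, hy, rfl⟩)
      · exact hRO hz
      · have hvy := hxmax _ y.2 ((hdomR y).mp hy)
        change (y : K) / x m ∈ O
        rw [← O.valuation_le_one_iff, map_div₀]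
        exact div_le_one_of_le₀ hvy zero_le
    have hICO : (integralClosure (blowupRing (R m).toSubring (x m)) K).toSubring ≤ O.toSubring :=
      fun z hz => mem_valuationSubring_of_isIntegral_of_subring_le O hBO hz
    have hRm1 : (R (m + 1)).toSubring =
        locAtCentre (integralClosure (blowupRing (R m).toSubring (x m)) K).toSubring O := by
      rw [hRsucc]
      have h2 := adjoin_setOf_isIntegral_toSubring_eq (k := k) (Algebra.adjoin k ((R m : Set K) ∪
        {w : K | ∃ a ∈ R m, O.valuation a < 1 ∧ w = a * (x m)⁻¹}))
      rw [hB₁] at h2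
      rw [adjoin_mul_inv_toSubring_eq_locAtCentre O _ (h2 ▸ hICO), h2]
    rw [← hRm1] at hrange₁
    -- side conditions at stage `m + 1`
    have hRO₁ : (R (m + 1)).toSubring ≤ O.toSubring := hRm1 ▸ locAtCentre_le hICO
    have hdom₁ : ∀ r, r ∈ maximalIdeal (S.step.X.presheaf.stalk P₁) ↔ O.valuation (ψ₁ r) < 1 :=
      mem_maximalIdeal_iff_of_range_eq_locAtCentre O ψ₁ hψ₁ hICO (hrange₁.trans hRm1)
    have hfrac₁ : ∀ z : K, ∃ a b : S.step.X.presheaf.stalk P₁, z = ψ₁ a / ψ₁ b := by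
      intro z
      obtain ⟨a, b, rfl⟩ := hfrac z
      have hsub : (R m).toSubring ≤ ψ₁.range := by
        rw [hrange₁, hRm1]
        exact le_locAtCentre_integralClosure_blowupRing O (R m).toSubring (x m)
      have ha : ψ a ∈ (R m).toSubring := hR ▸ ⟨a, rfl⟩
      have hb : ψ b ∈ (R m).toSubring := hR ▸ ⟨b, rfl⟩
      obtain ⟨a', ha'⟩ := hsub ha
      obtain ⟨b', hb'⟩ := hsub hb
      exact ⟨a', b', by rw [ha', hb']⟩
    -- induction
    obtain ⟨P', ψ', hψ', hrange'⟩ := ih (m + 1) S.step P₁ ψ₁ hψ₁ hrange₁ hRO₁ hdom₁ hfrac₁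
    have hmn : m + 1 + n = m + (n + 1) := by omega
    rw [hmn] at hrange'
    exact ⟨P', ψ', hψ', hrange'⟩

/-- **Lipman's theorem, valuative corollary, from the finiteness of Lipman's sequence
(`Lipman1978SequenceFinite`).** Given the data of `Lipman1978ValuativeQuadraticSequence`,
realise `R 0` as the local ring of an affine normal surface `X₀` over `k` at the centre of `O`
(`exists_normalSurface_point_range_eq`); if no `R i` were regular, the `R i` would be the local
rings of Lipman's `X_i = step^[i] X₀` at the centres of `O`
(`NormalSurface.exists_point_iterate_range_eq`), contradicting the regularity of some `X_n`.
[cite: Lipman1978, Theorem p. 151; Liu2002, Thm. 8.3.44 (PDF p. 427)] -/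
theorem Lipman1978ValuativeQuadraticSequence.of_sequenceFinite (h : Lipman1978SequenceFinite.{u}) :
    Lipman1978ValuativeQuadraticSequence.{u} := by
  intro k K _ _ _ O R x hk htr hess hfrac hRO hloc hnorm hstep
  by_contra hcon
  push Not at hcon
  haveI := hfrac
  -- the initial model
  obtain ⟨S, P, ψ, hψ, hR⟩ := exists_normalSurface_point_range_eq O (R 0) htr hess hfrac hRO hloc hnorm
  -- `R 0` is dominated by `O` and has fraction field `K`
  have hinvR : ∀ s ∈ R 0, O.valuation s = 1 → s⁻¹ ∈ R 0 := by
    intro s hs hvs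
    rw [← hloc]
    refine Algebra.subset_adjoin ⟨1, (R 0).one_mem, s, hs, ?_, by rw [one_mul]⟩
    rw [← O.valuation_le_one_iff, map_inv₀, hvs, inv_one]
  have hmemR : ∀ r, ψ r ∈ R 0 := fun r => show ψ r ∈ (R 0).toSubring from hR ▸ ⟨r, rfl⟩
  have hdom0 : ∀ r, r ∈ maximalIdeal (S.X.presheaf.stalk P) ↔ O.valuation (ψ r) < 1 := by
    intro r
    rw [IsLocalRing.mem_maximalIdeal, mem_nonunits_iff]
    have hle : O.valuation (ψ r) ≤ 1 := (O.valuation_le_one_iff _).mpr (hRO (hmemR r))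
    constructor
    · intro hnu
      refine lt_of_le_of_ne hle fun h1 => hnu ?_
      -- `(ψ r)⁻¹ ∈ R 0 = ψ(𝒪)`, so `r` is a unit
      obtain ⟨t, ht⟩ : (ψ r)⁻¹ ∈ ψ.range := hR ▸ (hinvR _ (hmemR r) h1)
      have h0 : ψ r ≠ 0 := ne_zero_of_valuation_eq_one h1
      have hrt : r * t = 1 := hψ (by rw [map_mul, ht, mul_inv_cancel₀ h0, map_one])
      exact ⟨⟨r, t, hrt, by rwa [mul_comm] at hrt⟩, rfl⟩
    · rintro hlt ⟨u, rfl⟩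
      have h1 : O.valuation (ψ ↑u) * O.valuation (ψ ↑u⁻¹) = 1 := by
        rw [← map_mul, ← map_mul, Units.mul_inv, map_one, map_one]
      have h2 : O.valuation (ψ ↑u⁻¹) ≤ 1 := (O.valuation_le_one_iff _).mpr (hRO (hmemR _))
      have : O.valuation (ψ ↑u) * O.valuation (ψ ↑u⁻¹) < 1 * 1 :=
        mul_lt_mul_of_lt_of_le_of_nonneg_of_pos hlt h2 zero_le zero_lt_one
      rw [h1, one_mul] at this
      exact lt_irrefl _ this
  have hfrac0 : ∀ z : K, ∃ a b : S.X.presheaf.stalk P, z = ψ a / ψ b := by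
    intro z
    obtain ⟨a, b, -, rfl⟩ := IsFractionRing.div_surjective (A := R 0) z
    obtain ⟨a', ha'⟩ : (a : K) ∈ ψ.range := hR ▸ a.2
    obtain ⟨b', hb'⟩ : (b : K) ∈ ψ.range := hR ▸ b.2
    exact ⟨a', b', by rw [ha', hb']; rfl⟩
  -- run Lipman's sequence along `O`
  obtain ⟨n, hn⟩ := h k S
  obtain ⟨P', ψ', hψ', hrange'⟩ := NormalSurface.exists_point_iterate_range_eq O R x hcon hstep n
    0 S P ψ hψ hR hRO hdom0 hfrac0
  rw [Nat.zero_add] at hrange'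
  exact hcon n ((isRegularLocalRing_iff_of_range_eq ψ' hψ' (R n) hrange').mp (hn P'))

end Assembly

end Literature.AlgebraicGeometry.Resolution

end
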